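import Mathlib
import Summits.KontsevichZagierPeriods.Zeta5Search.PolynomialResidues
import HarnessLib

/-!
# ζ(5) search — the algebraic residue theorem for poles of ANY order (sum of residues = coefficient at infinity)

HONEST FRAMING: systematic search; no irrationality claim unless certified.

Cell `pub-zeta5`, gen-2 seat generation 15 (REPORT-gen2-g15 §2; item (K)(D)(∞) of REPORT-gen2-g14 §6).  PROOF LAYER, pure algebra over
an arbitrary field `K` (no statement about ζ(5)): the generalisation of `PolynomialResidues.sum_res_eq_coeff_modByMonic` /
`sum_res_eq_zero` (pole orders `m_i ∈ {1,2}`, p3 gen 2) to ARBITRARY pole orders `m_i ≥ 1` — the form needed by the second residue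
law L5 (`SecondResidueLaw.LawA5`, staged), where the rational function `R̄_b·D^{M−4}` on `P¹(F_p)` has poles of order up to `4`.

Setting as in `PolynomialResidues`: a finite index set `s`, points `a i ∈ K` injective on `s`, multiplicities `m i ≥ 1`,
`B = ∏_{i∈s} (X − a_i)^{m_i}`, `n = Σ m_i`, cofactors `C_i = B/(X − a_i)^{m_i}` (`cofactor`, reused).  The RESIDUE of `A/B` at `a_i`
for a pole of any order is defined ALGEBRAICALLY (`resGen`): the coefficient of `X^{m_i − 1}` in the formal power series
`A(X + a_i) · C_i(X + a_i)⁻¹ ∈ K⟦X⟧` (`localExpansion`, the local expansion of `A/C_i` at `a_i`; `C_i(a_i) ≠ 0`, so the denominator is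
a unit of `K⟦X⟧`) — i.e. the classical `(1/(m−1)!)(d/dX)^{m−1}(A/C_i)(a_i)` WITHOUT factorials, valid in every characteristic.
* `resGen_eq_coeff_of_dvd` — ANY local approximation computes it: `deg r < m_i ∧ (X − a_i)^{m_i} ∣ A − r·C_i ⇒ resGen_i(A) = coeff_{m_i−1}(r)`;
* `sum_resGen_eq_coeff_modByMonic` — **`Σ_{i∈s} resGen_i(A) = coeff_{n−1}(A mod B)`** (minus the residue at infinity of `(A mod B)/B`);
* `sum_resGen_eq_zero` — **`deg A + 2 ≤ n ⇒ Σ_{i∈s} resGen_i(A) = 0`**;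
* `resGen_eq_res` — agreement with `PolynomialResidues.res` for `m_i ∈ {1,2}` (so the p3 gen-2 theorems are the special case).
Proof: Mathlib's polynomial partial fractions `A = q·B + Σ_i r_i·C_i` (`deg r_i < m_i`); the Taylor shift at `a_i` (`taylor`, a ring
map) turns `B` and every `C_j`, `j ≠ i`, into multiples of `X^{m_i}`, so the local expansion is `r_i(X + a_i) + X^{m_i}·(…)`, whose
coefficient of `X^{m_i−1}` is the top coefficient of `r_i`, which is the coefficient of `X^{n−1}` in `r_i·C_i` (`C_i` monic of degree `n − m_i`).
-/

open Finset Polynomial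

namespace Summit.KontsevichZagierPeriods.Zeta5Search.PolynomialResidues

variable {K : Type*} [Field K] {ι : Type*}

section Local

/-- The local expansion of `A/G` at the point `a` as a formal power series: `A(X + a) · G(X + a)⁻¹ ∈ K⟦X⟧`
(the Taylor expansion of the rational function `A/G` at `a` when `G(a) ≠ 0`). -/
noncomputable def localExpansion (a : K) (A G : K[X]) : PowerSeries K :=
  ((taylor a A : K[X]) : PowerSeries K) * (((taylor a G : K[X]) : PowerSeries K))⁻¹

/-- The Taylor shift at `a` sends `(X − a)^k` to `X^k`. -/
theorem taylor_X_sub_C_pow (a : K) (k : ℕ) : taylor a ((X - C a) ^ k) = X ^ k := by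
  rw [taylor_pow, map_sub, taylor_X, taylor_C, add_sub_cancel_right]

/-- The constant coefficient of the shifted polynomial, as a power series, is the value at the point. -/
theorem constantCoeff_coe_taylor (a : K) (f : K[X]) :
    PowerSeries.constantCoeff ((taylor a f : K[X]) : PowerSeries K) = f.eval a := by
  rw [Polynomial.constantCoeff_coe, taylor_coeff_zero]

/-- A polynomial of degree `< m` has the same coefficient of `X^{m−1}` before and after a Taylor shift (it is the top coefficient). -/
theorem taylor_coeff_pred_eq (a : K) {r : K[X]} {m : ℕ} (hr : r.natDegree < m) :
    (taylor a r).coeff (m - 1) = r.coeff (m - 1) := by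
  by_cases hd : r.natDegree = m - 1
  · have h1 : (taylor a r).coeff (m - 1) = (taylor a r).leadingCoeff := by
      rw [leadingCoeff, natDegree_taylor, hd]
    rw [h1, leadingCoeff_taylor, leadingCoeff, hd]
  · rw [coeff_eq_zero_of_natDegree_lt (by rw [natDegree_taylor]; omega), coeff_eq_zero_of_natDegree_lt (by omega)]

/-- **Any local approximation computes the local coefficient.**  If `G(a) ≠ 0`, `deg r < m` and `(X − a)^m ∣ A − r·G`, then the
coefficient of `X^{m−1}` in the local expansion `A(X+a)/G(X+a)` is the coefficient of `X^{m−1}` in `r`. -/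
theorem coeff_localExpansion_eq_of_dvd (a : K) (A G r : K[X]) (m : ℕ) (hG : G.eval a ≠ 0) (hr : r.natDegree < m)
    (hdiv : (X - C a) ^ m ∣ A - r * G) :
    PowerSeries.coeff (m - 1) (localExpansion a A G) = r.coeff (m - 1) := by
  obtain ⟨w, hw⟩ := hdiv
  have hA : A = r * G + (X - C a) ^ m * w := by rw [← hw]; ring
  have hGu : PowerSeries.constantCoeff ((taylor a G : K[X]) : PowerSeries K) ≠ 0 := by
    rwa [constantCoeff_coe_taylor]
  have hT : ((taylor a A : K[X]) : PowerSeries K)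
      = ((taylor a r : K[X]) : PowerSeries K) * ((taylor a G : K[X]) : PowerSeries K)
        + PowerSeries.X ^ m * ((taylor a w : K[X]) : PowerSeries K) := by
    rw [hA, map_add, taylor_mul, taylor_mul, taylor_X_sub_C_pow, Polynomial.coe_add, Polynomial.coe_mul, Polynomial.coe_mul,
      Polynomial.coe_pow, Polynomial.coe_X]
  have hexp : localExpansion a A G
      = ((taylor a r : K[X]) : PowerSeries K) + PowerSeries.X ^ m * (((taylor a w : K[X]) : PowerSeries K)
          * (((taylor a G : K[X]) : PowerSeries K))⁻¹) := by
    unfold localExpansion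
    rw [hT, add_mul, mul_assoc, PowerSeries.mul_inv_cancel _ hGu, mul_one, mul_assoc]
  rw [hexp, map_add, PowerSeries.coeff_X_pow_mul', if_neg (by omega), add_zero, Polynomial.coeff_coe,
    taylor_coeff_pred_eq a hr]

end Local

section Residues

variable [DecidableEq ι]

/-- **Residue at a pole of any order.**  The residue of `A / ∏_{k∈s} (X − a_k)^{m_k}` at the pole `a_i` of order `m_i ≥ 1`: the
coefficient of `X^{m_i − 1}` in the local expansion `A(X + a_i)/C_i(X + a_i) ∈ K⟦X⟧`, `C_i` the cofactor of `a_i`. -/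
noncomputable def resGen (s : Finset ι) (a : ι → K) (m : ι → ℕ) (A : K[X]) (i : ι) : K :=
  PowerSeries.coeff (m i - 1) (localExpansion (a i) A (cofactor s a m i))

/-- **Any local approximation computes the residue**: for `i ∈ s` (points distinct on `s`), `deg r < m_i` and
`(X − a_i)^{m_i} ∣ A − r·C_i` imply `resGen_i(A) = coeff_{m_i−1}(r)`. -/
theorem resGen_eq_coeff_of_dvd (s : Finset ι) (a : ι → K) (m : ι → ℕ) (ha : Set.InjOn a s) (A : K[X]) {i : ι}
    (hi : i ∈ s) (r : K[X]) (hr : r.natDegree < m i) (hdiv : (X - C (a i)) ^ m i ∣ A - r * cofactor s a m i) :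
    resGen s a m A i = r.coeff (m i - 1) :=
  coeff_localExpansion_eq_of_dvd (a i) A (cofactor s a m i) r (m i) (eval_cofactor_self_ne_zero s a m ha hi) hr hdiv

/-- The pole factor `(X − a_i)^{m_i}` divides every OTHER cofactor `C_j`, `j ≠ i`. -/
theorem X_sub_C_pow_dvd_cofactor {s : Finset ι} (a : ι → K) (m : ι → ℕ) {i j : ι} (hi : i ∈ s) (hji : j ≠ i) :
    (X - C (a i)) ^ m i ∣ cofactor s a m j := by
  unfold cofactor
  exact Finset.dvd_prod_of_mem (fun k => (X - C (a k)) ^ m k) (Finset.mem_erase.2 ⟨Ne.symm hji, hi⟩)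

/-- `B = (X − a_i)^{m_i} · C_i`. -/
theorem prod_eq_X_sub_C_pow_mul_cofactor (s : Finset ι) (a : ι → K) (m : ι → ℕ) {i : ι} (hi : i ∈ s) :
    ∏ k ∈ s, (X - C (a k)) ^ m k = (X - C (a i)) ^ m i * cofactor s a m i := by
  unfold cofactor
  rw [Finset.mul_prod_erase s (fun k => (X - C (a k)) ^ m k) hi]

/-- **Sum of residues = the coefficient at infinity, poles of any order.**  For distinct points `a_i` (`i ∈ s`) and multiplicities
`m_i ≥ 1`, with `B = ∏_{i∈s} (X − a_i)^{m_i}` of degree `n = Σ m_i`, the residues of `A/B` at the points `a_i` sum to the coefficient of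
`X^{n−1}` in `A mod B` — i.e. to minus the residue at infinity of `(A mod B)/B`. -/
theorem sum_resGen_eq_coeff_modByMonic (s : Finset ι) (a : ι → K) (m : ι → ℕ) (ha : Set.InjOn a s)
    (hm : ∀ i ∈ s, 1 ≤ m i) (A : K[X]) :
    ∑ i ∈ s, resGen s a m A i
      = (A %ₘ ∏ i ∈ s, (X - C (a i)) ^ m i).coeff (∑ i ∈ s, m i - 1) := by
  -- the monic, pairwise coprime system `g i = (X − a_i)^{m_i}` and Mathlib's polynomial partial fractions
  have hmon : ∀ i ∈ s, ((fun i => (X - C (a i)) ^ m i) i).Monic := fun i _ => (monic_X_sub_C (a i)).pow (m i)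
  have hcop : Set.Pairwise (s : Set ι) fun i j =>
      IsCoprime ((fun i => (X - C (a i)) ^ m i) i) ((fun i => (X - C (a i)) ^ m i) j) := by
    intro i hi j hj hij
    exact (isCoprime_X_sub_C_of_isUnit_sub (sub_ne_zero.2 fun h => hij (ha hi hj h)).isUnit).pow
  obtain ⟨q, r, hr, hArep⟩ := eq_quo_mul_prod_add_sum_rem_mul_prod A hmon hcop
  change A = q * (∏ i ∈ s, (X - C (a i)) ^ m i) + ∑ i ∈ s, r i * cofactor s a m i at hArep
  -- degrees
  have hB : (∏ i ∈ s, (X - C (a i)) ^ m i).Monic := monic_prod_of_monic _ _ hmon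
  have hBdeg : (∏ i ∈ s, (X - C (a i)) ^ m i).natDegree = ∑ i ∈ s, m i := by
    rw [natDegree_prod_of_monic _ _ hmon]
    refine Finset.sum_congr rfl fun i _ => ?_
    rw [(monic_X_sub_C (a i)).natDegree_pow, natDegree_X_sub_C, mul_one]
  have hcofdeg : ∀ i ∈ s, (cofactor s a m i).natDegree + m i = ∑ k ∈ s, m k := by
    intro i hi
    rw [natDegree_cofactor, Finset.sum_erase_add _ _ hi]
  have hrdeg : ∀ i ∈ s, (r i).natDegree < m i := by
    intro i hi
    by_cases h0 : r i = 0
    · rw [h0, natDegree_zero]; exact hm i hi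
    · have h1 := natDegree_lt_natDegree h0 (hr i hi)
      rwa [(monic_X_sub_C (a i)).natDegree_pow, natDegree_X_sub_C, mul_one] at h1
  -- `A mod B` is the partial-fraction numerator `Σ r_i C_i`
  have hSdeg : (∑ i ∈ s, r i * cofactor s a m i).degree < (∏ i ∈ s, (X - C (a i)) ^ m i).degree := by
    rw [degree_eq_natDegree hB.ne_zero, hBdeg]
    refine (degree_sum_le _ _).trans_lt ((Finset.sup_lt_iff (WithBot.bot_lt_coe _)).2 fun i hi => ?_)
    by_cases hri : r i = 0
    · rw [hri, zero_mul, degree_zero]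
      exact WithBot.bot_lt_coe _
    · rw [degree_eq_natDegree (mul_ne_zero hri (cofactor_monic s a m i).ne_zero)]
      have h1 := natDegree_mul_le (p := r i) (q := cofactor s a m i)
      have h2 := hcofdeg i hi
      have h3 := hrdeg i hi
      exact_mod_cast (show (r i * cofactor s a m i).natDegree < ∑ k ∈ s, m k by omega)
  have hmod : A %ₘ (∏ i ∈ s, (X - C (a i)) ^ m i) = ∑ i ∈ s, r i * cofactor s a m i :=
    (div_modByMonic_unique (f := A) q (∑ i ∈ s, r i * cofactor s a m i) hB
      ⟨by rw [hArep]; ring, hSdeg⟩).2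
  -- at each pole, `r_i` is a local approximation: `(X − a_i)^{m_i} ∣ A − r_i C_i = q B + Σ_{j ≠ i} r_j C_j`
  have hres : ∀ i ∈ s, resGen s a m A i = (r i).coeff (m i - 1) := by
    intro i hi
    refine resGen_eq_coeff_of_dvd s a m ha A hi (r i) (hrdeg i hi) ?_
    have e : A - r i * cofactor s a m i
        = q * ∏ k ∈ s, (X - C (a k)) ^ m k + ∑ j ∈ s.erase i, r j * cofactor s a m j := by
      rw [hArep, ← Finset.add_sum_erase s (fun j => r j * cofactor s a m j) hi]
      ring
    rw [e, prod_eq_X_sub_C_pow_mul_cofactor s a m hi]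
    refine dvd_add ((dvd_mul_right _ _).mul_left q) (Finset.dvd_sum fun j hj => ?_)
    exact dvd_mul_of_dvd_right (X_sub_C_pow_dvd_cofactor a m hi (Finset.mem_erase.1 hj).1) _
  -- termwise: the top coefficient of `r_i` is the coefficient of `X^{n−1}` in `r_i C_i`
  rw [hmod, finsetSum_coeff]
  refine Finset.sum_congr rfl fun i hi => ?_
  rw [hres i hi]
  have hmi := hm i hi
  have hcd : (cofactor s a m i).natDegree = ∑ k ∈ s, m k - m i := by have := hcofdeg i hi; omega
  have hsplit : ∑ k ∈ s, m k - 1 = (m i - 1) + (∑ k ∈ s, m k - m i) := by have := hcofdeg i hi; omega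
  have hlead : (cofactor s a m i).coeff (∑ k ∈ s, m k - m i) = 1 := by
    rw [← hcd]; exact (cofactor_monic s a m i).coeff_natDegree
  rw [hsplit, coeff_mul_add_eq_of_natDegree_le (by have := hrdeg i hi; omega) hcd.le, hlead, mul_one]

/-- **Sum of residues, poles of any order.**  For distinct points `a_i` (`i ∈ s`), multiplicities `m_i ≥ 1` and a polynomial `A`
with `deg A + 2 ≤ Σ_{i∈s} m_i`, the residues of `A / ∏_{i∈s} (X − a_i)^{m_i}` at the points `a_i` sum to zero. -/
theorem sum_resGen_eq_zero (s : Finset ι) (a : ι → K) (m : ι → ℕ) (ha : Set.InjOn a s) (hm : ∀ i ∈ s, 1 ≤ m i)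
    (A : K[X]) (hA : A.natDegree + 2 ≤ ∑ i ∈ s, m i) : ∑ i ∈ s, resGen s a m A i = 0 := by
  have hmon : ∀ i ∈ s, ((fun i => (X - C (a i)) ^ m i) i).Monic := fun i _ => (monic_X_sub_C (a i)).pow (m i)
  have hB : (∏ i ∈ s, (X - C (a i)) ^ m i).Monic := monic_prod_of_monic _ _ hmon
  have hBdeg : (∏ i ∈ s, (X - C (a i)) ^ m i).natDegree = ∑ i ∈ s, m i := by
    rw [natDegree_prod_of_monic _ _ hmon]
    refine Finset.sum_congr rfl fun i _ => ?_
    rw [(monic_X_sub_C (a i)).natDegree_pow, natDegree_X_sub_C, mul_one]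
  have hself : A %ₘ (∏ i ∈ s, (X - C (a i)) ^ m i) = A := by
    rw [modByMonic_eq_self_iff hB, degree_eq_natDegree hB.ne_zero, hBdeg]
    exact degree_le_natDegree.trans_lt (by exact_mod_cast (show A.natDegree < ∑ i ∈ s, m i by omega))
  rw [sum_resGen_eq_coeff_modByMonic s a m ha hm A, hself]
  exact coeff_eq_zero_of_natDegree_lt (by omega)

/-! ### Agreement with `res` at simple and double poles -/

/-- The coefficient of `X` in the shifted polynomial, as a power series, is the derivative at the point. -/
theorem coeff_one_coe_taylor (a : K) (f : K[X]) :
    PowerSeries.coeff 1 ((taylor a f : K[X]) : PowerSeries K) = (derivative f).eval a := by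
  rw [Polynomial.coeff_coe, taylor_coeff_one]

/-- Constant coefficient of a local expansion: `A(a)/G(a)`. -/
theorem coeff_zero_localExpansion (a : K) (A G : K[X]) :
    PowerSeries.coeff 0 (localExpansion a A G) = A.eval a / G.eval a := by
  unfold localExpansion
  rw [PowerSeries.coeff_zero_eq_constantCoeff_apply, map_mul, PowerSeries.constantCoeff_inv, constantCoeff_coe_taylor,
    constantCoeff_coe_taylor, div_eq_mul_inv]

/-- Coefficient of `X` of a local expansion (`G(a) ≠ 0`): `(A'(a)G(a) − A(a)G'(a))/G(a)²`. -/
theorem coeff_one_localExpansion (a : K) (A G : K[X]) (hG : G.eval a ≠ 0) :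
    PowerSeries.coeff 1 (localExpansion a A G)
      = ((derivative A).eval a * G.eval a - A.eval a * (derivative G).eval a) / G.eval a ^ 2 := by
  have hGu : PowerSeries.constantCoeff ((taylor a G : K[X]) : PowerSeries K) ≠ 0 := by
    rwa [constantCoeff_coe_taylor]
  -- the coefficient of `X` in `φ⁻¹` from `φ · φ⁻¹ = 1`
  set φ : PowerSeries K := ((taylor a G : K[X]) : PowerSeries K) with hφ
  have h1 : PowerSeries.coeff 1 (φ * φ⁻¹) = 0 := by
    rw [PowerSeries.mul_inv_cancel _ hGu, PowerSeries.coeff_one, if_neg one_ne_zero]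
  have hprod : ∀ ψ : PowerSeries K, PowerSeries.coeff 1 (ψ * φ⁻¹)
      = PowerSeries.coeff 0 ψ * PowerSeries.coeff 1 φ⁻¹ + PowerSeries.coeff 1 ψ * PowerSeries.coeff 0 φ⁻¹ := by
    intro ψ
    rw [PowerSeries.coeff_mul, Finset.Nat.antidiagonal_succ, Finset.sum_cons, Finset.Nat.antidiagonal_zero,
      Finset.map_singleton, Finset.sum_singleton]
    rfl
  have hc0 : PowerSeries.coeff 0 φ = G.eval a := by
    rw [PowerSeries.coeff_zero_eq_constantCoeff_apply, hφ, constantCoeff_coe_taylor]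
  have hc0i : PowerSeries.coeff 0 φ⁻¹ = (G.eval a)⁻¹ := by
    rw [PowerSeries.coeff_zero_eq_constantCoeff_apply, PowerSeries.constantCoeff_inv, hφ, constantCoeff_coe_taylor]
  have hc1 : PowerSeries.coeff 1 φ = (derivative G).eval a := by rw [hφ, coeff_one_coe_taylor]
  have hinv1 : PowerSeries.coeff 1 φ⁻¹ = -((derivative G).eval a) / G.eval a ^ 2 := by
    rw [hprod φ, hc0, hc0i, hc1] at h1
    have h2 := congrArg (· * G.eval a) h1
    simp only [add_mul, zero_mul, inv_mul_cancel_right₀ hG] at h2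
    rw [eq_div_iff (pow_ne_zero 2 hG)]
    linear_combination h2
  rw [localExpansion, ← hφ, hprod, hinv1, hc0i, PowerSeries.coeff_zero_eq_constantCoeff_apply, constantCoeff_coe_taylor,
    coeff_one_coe_taylor, eq_div_iff (pow_ne_zero 2 hG)]
  field_simp
  ring

/-- **`resGen` extends `res`**: at a simple or a double pole the algebraic residue is the classical formula of `PolynomialResidues.res`. -/
theorem resGen_eq_res (s : Finset ι) (a : ι → K) (m : ι → ℕ) (ha : Set.InjOn a s) (A : K[X]) {i : ι} (hi : i ∈ s)
    (hmi : m i = 1 ∨ m i = 2) : resGen s a m A i = res s a m A i := by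
  have hC0 := eval_cofactor_self_ne_zero s a m ha hi
  rcases hmi with h1 | h2
  · rw [resGen, res, if_pos h1, h1, show 1 - 1 = 0 from rfl, coeff_zero_localExpansion]
  · rw [resGen, res, if_neg (by omega), h2, show 2 - 1 = 1 from rfl, coeff_one_localExpansion _ _ _ hC0]

end Residues

end Summit.KontsevichZagierPeriods.Zeta5Search.PolynomialResidues
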